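import Summits.BirchSwinnertonDyer.Rank1Residual.GaloisImage.LocalThreeDivisibilityDeciderAt
import Literature.NumberTheory.EllipticCurves.CongruenceVisibilityLocalFactors
import HarnessLib

/-!
# KERNEL CERTIFICATE for `9 ≤ [E(ℚ) : 3E(ℚ)]` — the count road's rank-`2` input — from two
# rational points, two chord identities and four non-divisibility certificates
# (team n1011, row T-DIV3L, FILE D7 "T-IDX3" — lead R5-84 (e); names notice 2026-08-21T23:58Z)

HONEST FRAMING (cell `b2b-bsdres`, run/shared/lean/b2b/bsd-rank1-residual/, verbatim in every
file): the goal of the cell is to DELETE the COMBINATION-SHAPED residual classes of the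
Birch–Swinnerton-Dyer formula for ALL analytic-rank `≤ 1` elliptic curves over `ℚ` — "full BSD
formula for every rank `≤ 1` curve in class `C`" assembled STRICTLY from published theorems — so
that the rank-`≤ 1` remainder becomes exactly the CONSTRUCTION-SHAPED classes, which are TYPED
(missing-input `Prop`s), NOT attempted. This is not "finishing BSD". Team n1011 (N10/N11): research
route; this file is a TOOL; nothing is booked by it; no mark / label moved; X4 stays
CONSTRUCTION-SHAPED. THEOREMS only (no definition, no named fact, no `sorry`).

## What

The COUNT road of visibility (tree `WeierstrassCurve.exists_sha_ne_zero_of_congr`, Cremona–Mazur /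
Agashe–Stein) needs `[E(ℚ):3E(ℚ)] · ∏ #𝓛_v(E′) · 3 < [E′(ℚ):3E′(ℚ)]`; n1011-p03's ENDs feed the
right-hand side from `hrank : 2 ≤ E′.mordellWeilRank` (`3^rank ≤ index`) — a displayed EVIDENCE
binder (Cremona's rank) in every T-VIS3-REC row shape. This file certifies **`9 ≤ [E′(ℚ):3E′(ℚ)]`**
in the kernel instead:

* §1 `add_eq_some_of_coords` / `sub_eq_some_of_coords` — CHORD CERTIFICATES: for affine points with
  `x₁ ≠ x₂`, `P₁ ± P₂ = (x₃, y₃)` follows from the two rational identities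
  `addX x₁ x₂ λ = x₃`, `addY x₁ x₂ y₁ λ = y₃` with the chord slope `λ` (Mathlib
  `Affine.Point.add_of_X_ne`, `slope_of_X_ne`) — `decide`-able on literals;
* §2 `nine_le_index_of_not_mem` — pure group theory: in an additive commutative group, if
  `P₁, P₂, P₁ + P₂, P₁ − P₂ ∉ H ⊇ 3G` and `[G : H] ≠ 0` then `9 ≤ [G : H]` (the classes of
  `P₁, P₂` are `𝔽₃`-independent in `G/H`: the nine combinations `rP₁ + sP₂`, `r, s ∈ {0,1,2}`, are
  distinct modulo `H`);
* §3 END `nine_le_index_range_zsmul_three_of_checks` for `E′ = ⟨a₁,…,a₆⟩/ℚ`: two points, two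
  chord certificates and FOUR `threeNonDivCheckAt` certificates (FILE D3
  `not_mem_range_zsmul_three_of_check`: `P ∉ 3E′(ℚ)` at one auxiliary prime each) ⟹
  `9 ≤ (zsmulAddGroupHom 3).range.index` (finiteness of the index from the tree's
  `pow_mordellWeilRank_le_index_range_zsmul`); and `three_lt_index_…` in the count's currency.

Consumers: the `…_of_indexChecks` twins of n1011-p03's `X4RankZero.bsdp_*_of_congr_of_rank_two*`
(FILE D8, first refusal p03 / p18), T-VIS3-REC row shapes (`hrank` ↦ certificates).

References: [CremonaMazur2000] §3; [AgasheStein2002] Thm. 3.1; [SilvermanAEC2009] III.2.3 (group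
law), VIII.§1 (weak Mordell–Weil: finiteness of `E(ℚ)/3E(ℚ)`).
-/

set_option autoImplicit false

noncomputable section

open scoped Classical
open WeierstrassCurve

namespace Summit.BirchSwinnertonDyer.Rank1Residual.GaloisImage.DivisionDecider

/-! ### §1 Chord certificates -/

section Chord

variable {F : Type*} [Field F] [DecidableEq F] (V : WeierstrassCurve F)

/-- **Chord certificate (sum).** For nonsingular affine points with `x₁ ≠ x₂`:
`(x₁,y₁) + (x₂,y₂) = (x₃,y₃)` as soon as `addX x₁ x₂ λ = x₃` and `addY x₁ x₂ y₁ λ = y₃` for the chord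
slope `λ = (y₁ − y₂)/(x₁ − x₂)` (Mathlib `Affine.Point.add_of_X_ne`, `Affine.slope_of_X_ne`).
[cite: SilvermanAEC2009, Group Law Algorithm III.2.3] -/
theorem add_eq_some_of_coords {x₁ y₁ x₂ y₂ x₃ y₃ : F} (h₁ : V.toAffine.Nonsingular x₁ y₁)
    (h₂ : V.toAffine.Nonsingular x₂ y₂) (h₃ : V.toAffine.Nonsingular x₃ y₃) (hx : x₁ ≠ x₂)
    (hX : V.toAffine.addX x₁ x₂ ((y₁ - y₂) / (x₁ - x₂)) = x₃)
    (hY : V.toAffine.addY x₁ x₂ y₁ ((y₁ - y₂) / (x₁ - x₂)) = y₃) :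
    (Affine.Point.some x₁ y₁ h₁ : V.toAffine.Point) + Affine.Point.some x₂ y₂ h₂ =
      Affine.Point.some x₃ y₃ h₃ := by
  rw [Affine.Point.add_of_X_ne (h₁ := h₁) (h₂ := h₂) hx]
  simp only [Affine.Point.some.injEq]
  rw [Affine.slope_of_X_ne hx]
  exact ⟨hX, hY⟩

/-- **Chord certificate (difference).** `(x₁,y₁) − (x₂,y₂) = (x₃,y₃)` from the two identities
with the slope through `(x₁,y₁)` and `−(x₂,y₂) = (x₂, negY x₂ y₂)`.
[cite: SilvermanAEC2009, Group Law Algorithm III.2.3] -/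
theorem sub_eq_some_of_coords {x₁ y₁ x₂ y₂ x₃ y₃ : F} (h₁ : V.toAffine.Nonsingular x₁ y₁)
    (h₂ : V.toAffine.Nonsingular x₂ y₂) (h₃ : V.toAffine.Nonsingular x₃ y₃) (hx : x₁ ≠ x₂)
    (hX : V.toAffine.addX x₁ x₂ ((y₁ - V.toAffine.negY x₂ y₂) / (x₁ - x₂)) = x₃)
    (hY : V.toAffine.addY x₁ x₂ y₁ ((y₁ - V.toAffine.negY x₂ y₂) / (x₁ - x₂)) = y₃) :
    (Affine.Point.some x₁ y₁ h₁ : V.toAffine.Point) - Affine.Point.some x₂ y₂ h₂ =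
      Affine.Point.some x₃ y₃ h₃ := by
  rw [sub_eq_add_neg, Affine.Point.neg_some]
  exact add_eq_some_of_coords V h₁ _ h₃ hx hX hY

end Chord

/-! ### §2 `9 ≤ [G : H]` from four classes -/

section Index

variable {G : Type*} [AddCommGroup G] (H : AddSubgroup G)

/-- The eight non-trivial residues: if `P₁, P₂, P₁ + P₂, P₁ − P₂ ∉ H ⊇ 3G` then
`r • P₁ + s • P₂ ∉ H` for all integers `0 ≤ r, s < 3`, `(r, s) ≠ (0, 0)`. [folklore] -/
theorem zsmul_add_zsmul_not_mem_of_lt_three (hH : ∀ g : G, (3 : ℤ) • g ∈ H) (P₁ P₂ : G)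
    (h₁ : P₁ ∉ H) (h₂ : P₂ ∉ H) (hadd : P₁ + P₂ ∉ H) (hsub : P₁ - P₂ ∉ H)
    (r s : ℤ) (hr : 0 ≤ r) (hr' : r < 3) (hs : 0 ≤ s) (hs' : s < 3) (hrs : ¬ (r = 0 ∧ s = 0)) :
    r • P₁ + s • P₂ ∉ H := by
  intro hmem
  interval_cases r <;> interval_cases s
  · exact hrs ⟨rfl, rfl⟩
  · exact h₂ (by simpa using hmem)
  · -- (0,2): P₂ = 3P₂ - 2P₂
    refine h₂ ?_
    have e : P₂ = (3 : ℤ) • P₂ - ((0 : ℤ) • P₁ + (2 : ℤ) • P₂) := by module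
    rw [e]; exact H.sub_mem (hH P₂) hmem
  · exact h₁ (by simpa using hmem)
  · exact hadd (by simpa using hmem)
  · -- (1,2): P₁ - P₂ = (P₁ + 2P₂) - 3P₂
    refine hsub ?_
    have e : P₁ - P₂ = ((1 : ℤ) • P₁ + (2 : ℤ) • P₂) - (3 : ℤ) • P₂ := by module
    rw [e]; exact H.sub_mem hmem (hH P₂)
  · -- (2,0): P₁ = 3P₁ - 2P₁
    refine h₁ ?_
    have e : P₁ = (3 : ℤ) • P₁ - ((2 : ℤ) • P₁ + (0 : ℤ) • P₂) := by module
    rw [e]; exact H.sub_mem (hH P₁) hmem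
  · -- (2,1): P₁ - P₂ = 3P₁ - (2P₁ + P₂)
    refine hsub ?_
    have e : P₁ - P₂ = (3 : ℤ) • P₁ - ((2 : ℤ) • P₁ + (1 : ℤ) • P₂) := by module
    rw [e]; exact H.sub_mem (hH P₁) hmem
  · -- (2,2): P₁ + P₂ = 3(P₁ + P₂) - (2P₁ + 2P₂)
    refine hadd ?_
    have e : P₁ + P₂ = (3 : ℤ) • (P₁ + P₂) - ((2 : ℤ) • P₁ + (2 : ℤ) • P₂) := by module
    rw [e]; exact H.sub_mem (hH _) hmem

/-- Small integer combinations: if `c • P₁ + d • P₂ ∈ H` with `|c|, |d| ≤ 2` then `c = d = 0`.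
[folklore] -/
theorem eq_zero_of_zsmul_add_zsmul_mem (hH : ∀ g : G, (3 : ℤ) • g ∈ H) (P₁ P₂ : G)
    (h₁ : P₁ ∉ H) (h₂ : P₂ ∉ H) (hadd : P₁ + P₂ ∉ H) (hsub : P₁ - P₂ ∉ H)
    (c d : ℤ) (hc : -2 ≤ c) (hc' : c ≤ 2) (hd : -2 ≤ d) (hd' : d ≤ 2)
    (hmem : c • P₁ + d • P₂ ∈ H) : c = 0 ∧ d = 0 := by
  -- reduce `c, d` modulo `3`
  set r := c % 3 with hr
  set s := d % 3 with hs
  have hr0 : 0 ≤ r := by omega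
  have hr3 : r < 3 := by omega
  have hs0 : 0 ≤ s := by omega
  have hs3 : s < 3 := by omega
  have hcr : r = c - 3 * (c / 3) := by omega
  have hds : s = d - 3 * (d / 3) := by omega
  have hmem' : r • P₁ + s • P₂ ∈ H := by
    have e : r • P₁ + s • P₂ =
        (c • P₁ + d • P₂) - (3 : ℤ) • ((c / 3) • P₁ + (d / 3) • P₂) := by
      rw [hcr, hds]
      module
    rw [e]
    exact H.sub_mem hmem (hH _)
  by_cases hrs : r = 0 ∧ s = 0
  · obtain ⟨hr0', hs0'⟩ := hrs
    omega
  · exact absurd hmem' (zsmul_add_zsmul_not_mem_of_lt_three H hH P₁ P₂ h₁ h₂ hadd hsub r s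
      hr0 hr3 hs0 hs3 hrs)

/-- **`9 ≤ [G : H]`** when `H ⊇ 3G` has finite (non-zero) index and `P₁, P₂, P₁ + P₂, P₁ − P₂ ∉ H`:
the nine classes `r P₁ + s P₂ + H`, `r, s ∈ {0, 1, 2}`, are pairwise distinct. [folklore] -/
theorem nine_le_index_of_not_mem (hH : ∀ g : G, (3 : ℤ) • g ∈ H) (P₁ P₂ : G)
    (h₁ : P₁ ∉ H) (h₂ : P₂ ∉ H) (hadd : P₁ + P₂ ∉ H) (hsub : P₁ - P₂ ∉ H)
    (hfin : H.index ≠ 0) : 9 ≤ H.index := by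
  haveI : Fintype (G ⧸ H) := AddSubgroup.fintypeOfIndexNeZero hfin
  let g : Fin 3 × Fin 3 → G ⧸ H :=
    fun u => QuotientAddGroup.mk (((u.1 : ℕ) : ℤ) • P₁ + ((u.2 : ℕ) : ℤ) • P₂)
  have hg : Function.Injective g := by
    rintro ⟨a, b⟩ ⟨a', b'⟩ huv
    have hmem := (QuotientAddGroup.eq (s := H)).mp huv
    have e : -((((a : ℕ) : ℤ)) • P₁ + (((b : ℕ) : ℤ)) • P₂) +
        ((((a' : ℕ) : ℤ)) • P₁ + (((b' : ℕ) : ℤ)) • P₂) =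
        (((a' : ℕ) : ℤ) - ((a : ℕ) : ℤ)) • P₁ + (((b' : ℕ) : ℤ) - ((b : ℕ) : ℤ)) • P₂ := by
      module
    rw [e] at hmem
    have ha := a.2; have ha' := a'.2; have hb := b.2; have hb' := b'.2
    obtain ⟨hc, hd⟩ := eq_zero_of_zsmul_add_zsmul_mem H hH P₁ P₂ h₁ h₂ hadd hsub _ _
      (by omega) (by omega) (by omega) (by omega) hmem
    have haa : (a : ℕ) = a' := by omega
    have hbb : (b : ℕ) = b' := by omega
    exact Prod.ext (Fin.ext haa) (Fin.ext hbb)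
  have hcard := Fintype.card_le_of_injective g hg
  rw [Fintype.card_prod, Fintype.card_fin] at hcard
  rw [AddSubgroup.index, Nat.card_eq_fintype_card]
  exact hcard

end Index

/-! ### §3 The END for `E′ = ⟨a₁, …, a₆⟩ / ℚ` -/

section Main

variable (a₁ a₂ a₃ a₄ a₆ : ℤ)

/-- **KERNEL CERTIFICATE `9 ≤ [E′(ℚ) : 3E′(ℚ)]`.** For the elliptic `W′ = ⟨a₁, …, a₆⟩ / ℚ`, two
affine points `P₁ = (x₁, y₁)`, `P₂ = (x₂, y₂)` with `x₁ ≠ x₂`, chord certificates for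
`P₃ = P₁ + P₂ = (x₃, y₃)` and `P₄ = P₁ − P₂ = (x₄, y₄)` (§1), and four NO certificates
`threeNonDivCheckAt ℓᵢ … (num xᵢ) (den xᵢ) kᵢ` (FILE D3: `Pᵢ ∉ 3E′(ℚ)`), the subgroup `3E′(ℚ)` has
index at least `9` — the classes of `P₁, P₂` are `𝔽₃`-independent in `E′(ℚ)/3E′(ℚ)` (§2; finite
index by the tree's `pow_mordellWeilRank_le_index_range_zsmul`, weak Mordell–Weil). This is the
count road's input `3^2 ≤ [E′(ℚ):3E′(ℚ)]` WITHOUT a rank statement.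
[cite: SilvermanAEC2009, Thm. VIII.6.7] -/
theorem nine_le_index_range_zsmul_three_of_checks (W' : WeierstrassCurve ℚ) [W'.IsElliptic]
    (hW' : W' = ⟨a₁, a₂, a₃, a₄, a₆⟩) {x₁ y₁ x₂ y₂ x₃ y₃ x₄ y₄ : ℚ}
    (h₁ : W'.toAffine.Nonsingular x₁ y₁) (h₂ : W'.toAffine.Nonsingular x₂ y₂)
    (h₃ : W'.toAffine.Nonsingular x₃ y₃) (h₄ : W'.toAffine.Nonsingular x₄ y₄) (hx : x₁ ≠ x₂)
    (hX₃ : W'.toAffine.addX x₁ x₂ ((y₁ - y₂) / (x₁ - x₂)) = x₃)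
    (hY₃ : W'.toAffine.addY x₁ x₂ y₁ ((y₁ - y₂) / (x₁ - x₂)) = y₃)
    (hX₄ : W'.toAffine.addX x₁ x₂ ((y₁ - W'.toAffine.negY x₂ y₂) / (x₁ - x₂)) = x₄)
    (hY₄ : W'.toAffine.addY x₁ x₂ y₁ ((y₁ - W'.toAffine.negY x₂ y₂) / (x₁ - x₂)) = y₄)
    {ℓ₁ ℓ₂ ℓ₃ ℓ₄ : ℕ} [hℓ₁ : Fact ℓ₁.Prime] [hℓ₂ : Fact ℓ₂.Prime] [hℓ₃ : Fact ℓ₃.Prime]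
    [hℓ₄ : Fact ℓ₄.Prime] {k₁ k₂ k₃ k₄ : ℕ}
    (hc₁ : threeNonDivCheckAt ℓ₁ a₁ a₂ a₃ a₄ a₆ x₁.num x₁.den k₁ = true)
    (hc₂ : threeNonDivCheckAt ℓ₂ a₁ a₂ a₃ a₄ a₆ x₂.num x₂.den k₂ = true)
    (hc₃ : threeNonDivCheckAt ℓ₃ a₁ a₂ a₃ a₄ a₆ x₃.num x₃.den k₃ = true)
    (hc₄ : threeNonDivCheckAt ℓ₄ a₁ a₂ a₃ a₄ a₆ x₄.num x₄.den k₄ = true) :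
    9 ≤ (zsmulAddGroupHom ((3 : ℕ) : ℤ) : W'.toAffine.Point →+ W'.toAffine.Point).range.index := by
  set H := (zsmulAddGroupHom ((3 : ℕ) : ℤ) : W'.toAffine.Point →+ W'.toAffine.Point).range with hH
  have hmem : ∀ g : W'.toAffine.Point, (3 : ℤ) • g ∈ H := fun g => ⟨g, rfl⟩
  have hP₁ := not_mem_range_zsmul_three_of_check ℓ₁ a₁ a₂ a₃ a₄ a₆ W' hW' h₁ hc₁
  have hP₂ := not_mem_range_zsmul_three_of_check ℓ₂ a₁ a₂ a₃ a₄ a₆ W' hW' h₂ hc₂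
  have hP₃ := not_mem_range_zsmul_three_of_check ℓ₃ a₁ a₂ a₃ a₄ a₆ W' hW' h₃ hc₃
  have hP₄ := not_mem_range_zsmul_three_of_check ℓ₄ a₁ a₂ a₃ a₄ a₆ W' hW' h₄ hc₄
  rw [← add_eq_some_of_coords W' h₁ h₂ h₃ hx hX₃ hY₃] at hP₃
  rw [← sub_eq_some_of_coords W' h₁ h₂ h₄ hx hX₄ hY₄] at hP₄
  have hfin : H.index ≠ 0 := by
    -- `3 ^ rank ≤ index` (tree `pow_mordellWeilRank_le_index_range_zsmul`, weak Mordell–Weil); the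
    -- tree states it with the classical `DecidableEq ℚ` on the point group, this file's `H` carries
    -- Mathlib's computable one — the SAME subgroup: we transport along `Subsingleton.elim` on the
    -- instance (an instance-diamond identification, no mathematical content).
    have key : ∀ d : DecidableEq ℚ, 3 ^ W'.mordellWeilRank ≤
        (letI : DecidableEq ℚ := d
         (zsmulAddGroupHom ((3 : ℕ) : ℤ) : W'.toAffine.Point →+ W'.toAffine.Point).range.index) := by
      intro d
      obtain rfl : d = fun a b => Classical.propDecidable (a = b) := Subsingleton.elim _ _
      exact pow_mordellWeilRank_le_index_range_zsmul W' (n := 3) (by norm_num)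
    have h3 : 3 ^ W'.mordellWeilRank ≤ H.index := key inferInstance
    intro h0
    rw [h0] at h3
    exact absurd h3 (not_le.mpr (pow_pos (by norm_num) _))
  exact nine_le_index_of_not_mem H hmem _ _ hP₁ hP₂ hP₃ hP₄ hfin

/-- **The same bound for ANY `DecidableEq ℚ` instance on the point group.** Mathlib's group law on
`E′(ℚ)` takes a `DecidableEq ℚ` argument; the END above carries the computable instance, the tree's
count theorems (`exists_sha_ne_zero_of_congr`, generic number field, `open Classical`) the classical
one — the SAME subgroup and index. This transport along `Subsingleton.elim` on the instance is an
instance-diamond identification with no mathematical content (FILE D8 consumes this form).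
[folklore] -/
theorem nine_le_index_range_zsmul_three_of_checks_inst (W' : WeierstrassCurve ℚ) [W'.IsElliptic]
    (hW' : W' = ⟨a₁, a₂, a₃, a₄, a₆⟩) {x₁ y₁ x₂ y₂ x₃ y₃ x₄ y₄ : ℚ}
    (h₁ : W'.toAffine.Nonsingular x₁ y₁) (h₂ : W'.toAffine.Nonsingular x₂ y₂)
    (h₃ : W'.toAffine.Nonsingular x₃ y₃) (h₄ : W'.toAffine.Nonsingular x₄ y₄) (hx : x₁ ≠ x₂)
    (hX₃ : W'.toAffine.addX x₁ x₂ ((y₁ - y₂) / (x₁ - x₂)) = x₃)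
    (hY₃ : W'.toAffine.addY x₁ x₂ y₁ ((y₁ - y₂) / (x₁ - x₂)) = y₃)
    (hX₄ : W'.toAffine.addX x₁ x₂ ((y₁ - W'.toAffine.negY x₂ y₂) / (x₁ - x₂)) = x₄)
    (hY₄ : W'.toAffine.addY x₁ x₂ y₁ ((y₁ - W'.toAffine.negY x₂ y₂) / (x₁ - x₂)) = y₄)
    {ℓ₁ ℓ₂ ℓ₃ ℓ₄ : ℕ} [hℓ₁ : Fact ℓ₁.Prime] [hℓ₂ : Fact ℓ₂.Prime] [hℓ₃ : Fact ℓ₃.Prime]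
    [hℓ₄ : Fact ℓ₄.Prime] {k₁ k₂ k₃ k₄ : ℕ}
    (hc₁ : threeNonDivCheckAt ℓ₁ a₁ a₂ a₃ a₄ a₆ x₁.num x₁.den k₁ = true)
    (hc₂ : threeNonDivCheckAt ℓ₂ a₁ a₂ a₃ a₄ a₆ x₂.num x₂.den k₂ = true)
    (hc₃ : threeNonDivCheckAt ℓ₃ a₁ a₂ a₃ a₄ a₆ x₃.num x₃.den k₃ = true)
    (hc₄ : threeNonDivCheckAt ℓ₄ a₁ a₂ a₃ a₄ a₆ x₄.num x₄.den k₄ = true) (d : DecidableEq ℚ) :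
    9 ≤ (letI : DecidableEq ℚ := d
      (zsmulAddGroupHom ((3 : ℕ) : ℤ) : W'.toAffine.Point →+ W'.toAffine.Point).range.index) := by
  obtain rfl : d = instDecidableEqRat := Subsingleton.elim _ _
  exact nine_le_index_range_zsmul_three_of_checks a₁ a₂ a₃ a₄ a₆ W' hW' h₁ h₂ h₃ h₄ hx hX₃ hY₃ hX₄
    hY₄ hc₁ hc₂ hc₃ hc₄

end Main


/-! ### §4 One instance by `decide` (EVIDENCE-grade nonsingularity displayed) -/

section Instance

/-- **Instance `75135b1`** (`[1, 0, 1, -63, 163]`, Cremona rank 2, generators `P₁ = (-1, 15)`,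
`P₂ = (11/4, 15/8)`; chord points `P₁ + P₂ = (7, 5)`, `P₁ − P₂ = (23, 93)`): `9 ≤ [E′(ℚ) : 3E′(ℚ)]`
with the four NO certificates at the primes `3, 3, 13, 3` — the count road's `3² ≤ index` input for
every T-VIS3 pair with this partner, no rank statement. [folklore] -/
theorem nine_le_index_75135b1 (W' : WeierstrassCurve ℚ) [W'.IsElliptic]
    (hW' : W' = ⟨1, 0, 1, -63, 163⟩) (h₁ : W'.toAffine.Nonsingular (-1) 15)
    (h₂ : W'.toAffine.Nonsingular (11 / 4) (15 / 8)) (h₃ : W'.toAffine.Nonsingular 7 5)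
    (h₄ : W'.toAffine.Nonsingular 23 93) :
    9 ≤ (zsmulAddGroupHom ((3 : ℕ) : ℤ) : W'.toAffine.Point →+ W'.toAffine.Point).range.index :=
  nine_le_index_range_zsmul_three_of_checks 1 0 1 (-63) 163 W' hW' h₁ h₂ h₃ h₄ (by norm_num)
    (by subst hW'; decide +kernel) (by subst hW'; decide +kernel) (by subst hW'; decide +kernel)
    (by subst hW'; decide +kernel)
    (ℓ₁ := 3) (ℓ₂ := 3) (ℓ₃ := 13) (ℓ₄ := 3) (hℓ₁ := ⟨Nat.prime_three⟩) (hℓ₂ := ⟨Nat.prime_three⟩)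
    (hℓ₃ := ⟨by norm_num⟩) (hℓ₄ := ⟨Nat.prime_three⟩) (k₁ := 2) (k₂ := 2) (k₃ := 1) (k₄ := 2)
    (by decide +kernel) (by decide +kernel) (by decide +kernel) (by decide +kernel)

end Instance

end Summit.BirchSwinnertonDyer.Rank1Residual.GaloisImage.DivisionDecider

end
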